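import Summits.CriticalPhenomena.PercolationContinuityZ3.Theorems.PercNearOneGluingNoHeavyLowerTailPivotalDualRowR4
import HarnessLib

/-!
# `NoHeavyLowerTail` (stmt-CriticalPhenomena-4575) — the pivotal refinement, VIII: the rows dR3 and dR4⁺ for `prodBernoulli` (measure form)

Support file (prover prim-gen-kcluster gen 44; `--supports stmt-CriticalPhenomena-4575`).  No named facts, no sorries, no definitions.
The kernel rows `PivotalBHK.dualRowR3_H` (part VI) and `PivotalBHK.dualRowR4_H` (part VII) transported to the measure vocabulary used by most of
the tree: for every finite vertex type, all edge weights `w : Sym2 V → [0,1]`, `μ = prodBernoulli w`, and pairwise distinct vertices `a, b, c`,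
writing `ω ∖ x := {e ∈ ω | x ∉ e}` (the configuration with the pairs at `x` deleted) and
`H_a = {ω ∖ a ∈ openConn b c}` ("`b ~ c` off `a`"), `H_b = {ω ∖ b ∈ openConn a c}`, `H_c = {ω ∖ c ∈ openConn a b}`:

* **dR3** (`dualRowR3_prodBernoulli`): `μ(H_b H_c ¬H_a) · μ(H_a H_c ¬H_b) ≤ μ(H_c ¬H_a ¬H_b) · μ(H_a H_b H_c)` — conditionally on
  `{a ~ b off c}`, the events `{a ~ c off b}` and `{b ~ c off a}` are positively correlated;
* its conditional-correlation form (`posCorr_PrW`, `posCorr_prodBernoulli`): `μ(H_b H_c) · μ(H_a H_c) ≤ μ(H_c) · μ(H_a H_b H_c)`;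
* **dR4⁺** (`dualRowR4_prodBernoulli`): `μ(H_b H_c ¬H_a) · (μ(H_a ¬H_b ¬H_c) + μ(H_a H_b ¬H_c)) ≤ μ(H_b ¬H_a ¬H_c) · (μ(H_a H_b H_c) + μ(H_a H_c ¬H_b))`,
  i.e. `P(H_c | H_b ¬H_a) ≤ P(H_c | H_a)`.
[cite: VandenbergHaggstromKahn2005, Thm. 1.4 (p. 7)] for the BHK input of both rows.
-/

noncomputable section

namespace Summit.CriticalPhenomena.PercolationContinuityZ3.Theorems

namespace PivotalBHK

open Finset Literature.Probability.Percolation Literature.Probability.Percolation.DecisionTree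
open Literature.Probability.Percolation.Gladkov ThreePointLB ThreePointGamma
open MeasureTheory Literature.Probability.LatticeModels
open scoped Classical

variable {V : Type*}

section Finitary

variable [Fintype V] [DecidableEq V] (D : Finset (Sym2 V)) {p : Sym2 V → ℝ} (hp0 : ∀ e, 0 ≤ p e) (hp1 : ∀ e, p e ≤ 1) {a b c : V}
include hp0 hp1

/-- **dR3 as a conditional positive correlation, finitary form**: with `H_a = (pivEv a b c)ᶜ = {b ~ c off a}`, `H_b = {a ~ c off b}`,
`H_c = {a ~ b off c}` (pairwise distinct terminals), `P(H_b ∩ H_c) · P(H_a ∩ H_c) ≤ P(H_c) · P(H_a ∩ H_b ∩ H_c)`: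
given `{a ~ b off c}`, the events `{a ~ c off b}` and `{b ~ c off a}` are positively correlated. [this work] -/
theorem posCorr_PrW (hab : a ≠ b) (hac : a ≠ c) (hbc : b ≠ c) :
    PrW D p ((pivEv b a c)ᶜ ∩ (pivEv c a b)ᶜ) * PrW D p ((pivEv a b c)ᶜ ∩ (pivEv c a b)ᶜ) ≤
      PrW D p (pivEv c a b)ᶜ * PrW D p ((pivEv a b c)ᶜ ∩ (pivEv b a c)ᶜ ∩ (pivEv c a b)ᶜ) := by
  have key := dualRowR3_H D hp0 hp1 hab hac hbc
  have sp := PrW_eq_inter_add_inter_compl D p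
  set Pa : Set (Finset (Sym2 V)) := pivEv a b c
  set Pb : Set (Finset (Sym2 V)) := pivEv b a c
  set Pc : Set (Finset (Sym2 V)) := pivEv c a b
  -- `P(H_b H_c) = T₀ + T_a`, `P(H_a H_c) = T₀ + T_b`, `P(H_c) = (T₀ + T_b) + (T_a + u_c)`
  have e1 : PrW D p (Pbᶜ ∩ Pcᶜ) = PrW D p (Paᶜ ∩ Pbᶜ ∩ Pcᶜ) + PrW D p (Pa ∩ Pbᶜ ∩ Pcᶜ) := by
    rw [sp (Pbᶜ ∩ Pcᶜ) Paᶜ, compl_compl]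
    have f1 : Pbᶜ ∩ Pcᶜ ∩ Paᶜ = Paᶜ ∩ Pbᶜ ∩ Pcᶜ := by
      ext K; simp only [Set.mem_inter_iff, Set.mem_compl_iff]; tauto
    have f2 : Pbᶜ ∩ Pcᶜ ∩ Pa = Pa ∩ Pbᶜ ∩ Pcᶜ := by
      ext K; simp only [Set.mem_inter_iff, Set.mem_compl_iff]; tauto
    rw [f1, f2]
  have e2 : PrW D p (Paᶜ ∩ Pcᶜ) = PrW D p (Paᶜ ∩ Pbᶜ ∩ Pcᶜ) + PrW D p (Paᶜ ∩ Pb ∩ Pcᶜ) := by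
    rw [sp (Paᶜ ∩ Pcᶜ) Pbᶜ, compl_compl]
    have f1 : Paᶜ ∩ Pcᶜ ∩ Pbᶜ = Paᶜ ∩ Pbᶜ ∩ Pcᶜ := by
      ext K; simp only [Set.mem_inter_iff, Set.mem_compl_iff]; tauto
    have f2 : Paᶜ ∩ Pcᶜ ∩ Pb = Paᶜ ∩ Pb ∩ Pcᶜ := by
      ext K; simp only [Set.mem_inter_iff, Set.mem_compl_iff]; tauto
    rw [f1, f2]
  have e3 : PrW D p Pcᶜ = PrW D p (Paᶜ ∩ Pcᶜ) + (PrW D p (Pa ∩ Pbᶜ ∩ Pcᶜ) + PrW D p (Pa ∩ Pb ∩ Pcᶜ)) := by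
    rw [sp Pcᶜ Paᶜ, compl_compl, Set.inter_comm Pcᶜ Paᶜ, sp (Pcᶜ ∩ Pa) Pbᶜ, compl_compl]
    have f1 : Pcᶜ ∩ Pa ∩ Pbᶜ = Pa ∩ Pbᶜ ∩ Pcᶜ := by
      ext K; simp only [Set.mem_inter_iff, Set.mem_compl_iff]; tauto
    have f2 : Pcᶜ ∩ Pa ∩ Pb = Pa ∩ Pb ∩ Pcᶜ := by
      ext K; simp only [Set.mem_inter_iff, Set.mem_compl_iff]; tauto
    rw [f1, f2]
  rw [e1, e3, e2]
  have n1 := PrW_nonneg D hp0 hp1 (p := p) (Paᶜ ∩ Pbᶜ ∩ Pcᶜ)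
  have n2 := PrW_nonneg D hp0 hp1 (p := p) (Pa ∩ Pbᶜ ∩ Pcᶜ)
  have n3 := PrW_nonneg D hp0 hp1 (p := p) (Paᶜ ∩ Pb ∩ Pcᶜ)
  have n4 := PrW_nonneg D hp0 hp1 (p := p) (Pa ∩ Pb ∩ Pcᶜ)
  nlinarith [key, mul_nonneg n1 n1, mul_nonneg n1 n2, mul_nonneg n1 n3, mul_nonneg n1 n4, mul_nonneg n2 n3]

end Finitary

section Measure

variable [Finite V]

/-- **dR3, measure form**: for `μ = prodBernoulli w` on any finite vertex type and pairwise distinct `a, b, c`,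
`μ(a~c off b, a~b off c, ¬ b~c off a) · μ(b~c off a, a~b off c, ¬ a~c off b) ≤ μ(a~b off c only) · μ(all three)` — given `{a ~ b off c}`,
the events `{a ~ c off b}` and `{b ~ c off a}` are positively correlated. [this work] -/
theorem dualRowR3_prodBernoulli (w : Sym2 V → unitInterval) {a b c : V} (hab : a ≠ b) (hac : a ≠ c) (hbc : b ≠ c) :
    (prodBernoulli w).real {ω : BondConfig V | {e | e ∈ ω ∧ a ∉ e} ∉ openConn b c ∧ {e | e ∈ ω ∧ b ∉ e} ∈ openConn a c ∧
          {e | e ∈ ω ∧ c ∉ e} ∈ openConn a b} *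
        (prodBernoulli w).real {ω : BondConfig V | {e | e ∈ ω ∧ a ∉ e} ∈ openConn b c ∧ {e | e ∈ ω ∧ b ∉ e} ∉ openConn a c ∧
          {e | e ∈ ω ∧ c ∉ e} ∈ openConn a b} ≤
      (prodBernoulli w).real {ω : BondConfig V | {e | e ∈ ω ∧ a ∉ e} ∉ openConn b c ∧ {e | e ∈ ω ∧ b ∉ e} ∉ openConn a c ∧
          {e | e ∈ ω ∧ c ∉ e} ∈ openConn a b} *
        (prodBernoulli w).real {ω : BondConfig V | {e | e ∈ ω ∧ a ∉ e} ∈ openConn b c ∧ {e | e ∈ ω ∧ b ∉ e} ∈ openConn a c ∧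
          {e | e ∈ ω ∧ c ∉ e} ∈ openConn a b} := by
  obtain ⟨_instV⟩ := nonempty_fintype V
  have hp0 : ∀ e, 0 ≤ (w e : ℝ) := fun e => (w e).2.1
  have hp1 : ∀ e, (w e : ℝ) ≤ 1 := fun e => (w e).2.2
  have key := dualRowR3_H (p := fun e => (w e : ℝ)) Finset.univ hp0 hp1 hab hac hbc
  have hco : ∀ (S : Finset (Sym2 V)) (u v : V),
      (↑S : Set (Sym2 V)) ∈ openConn u v ↔ (openGraph (↑S : Set (Sym2 V))).Reachable u v := fun _ _ _ => Iff.rfl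
  have hcoe : ∀ (S : Finset (Sym2 V)) (x : V), (↑(S \ touch {x}) : Set (Sym2 V)) = {e | e ∈ (↑S : Set (Sym2 V)) ∧ x ∉ e} := by
    intro S x; ext e
    simp only [Finset.coe_sdiff, Set.mem_sdiff, Finset.mem_coe, mem_touch, Finset.mem_singleton, exists_eq_left, Set.mem_setOf_eq]
  -- transport of any Boolean combination of the three avoiding-connection events to the finitary `PrW` form
  have conv : ∀ P : Prop → Prop → Prop → Prop,
      (prodBernoulli w).real {ω : BondConfig V | P ({e | e ∈ ω ∧ a ∉ e} ∈ openConn b c) ({e | e ∈ ω ∧ b ∉ e} ∈ openConn a c)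
          ({e | e ∈ ω ∧ c ∉ e} ∈ openConn a b)} =
        PrW Finset.univ (fun e => (w e : ℝ))
          {K : Finset (Sym2 V) | P (K ∉ pivEv a b c) (K ∉ pivEv b a c) (K ∉ pivEv c a b)} := fun P =>
    prodBernoulli_real_eq_PrW_univ w fun S => by
      simp only [Set.mem_setOf_eq, mem_pivEv, mem_cl, not_not, hco, ← hcoe]
  have h1 := conv fun x y z => ¬x ∧ y ∧ z
  have h2 := conv fun x y z => x ∧ ¬y ∧ z
  have h3 := conv fun x y z => ¬x ∧ ¬y ∧ z
  have h4 := conv fun x y z => x ∧ y ∧ z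
  beta_reduce at h1 h2 h3 h4
  simp only [not_not] at h1 h2 h3 h4
  have s1 : ({K : Finset (Sym2 V) | K ∈ pivEv a b c ∧ K ∉ pivEv b a c ∧ K ∉ pivEv c a b} : Set (Finset (Sym2 V))) =
      pivEv a b c ∩ (pivEv b a c)ᶜ ∩ (pivEv c a b)ᶜ := by
    ext K; simp only [Set.mem_setOf_eq, Set.mem_inter_iff, Set.mem_compl_iff, and_assoc]
  have s2 : ({K : Finset (Sym2 V) | K ∉ pivEv a b c ∧ K ∈ pivEv b a c ∧ K ∉ pivEv c a b} : Set (Finset (Sym2 V))) =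
      (pivEv a b c)ᶜ ∩ pivEv b a c ∩ (pivEv c a b)ᶜ := by
    ext K; simp only [Set.mem_setOf_eq, Set.mem_inter_iff, Set.mem_compl_iff, and_assoc]
  have s3 : ({K : Finset (Sym2 V) | K ∈ pivEv a b c ∧ K ∈ pivEv b a c ∧ K ∉ pivEv c a b} : Set (Finset (Sym2 V))) =
      pivEv a b c ∩ pivEv b a c ∩ (pivEv c a b)ᶜ := by
    ext K; simp only [Set.mem_setOf_eq, Set.mem_inter_iff, Set.mem_compl_iff, and_assoc]
  have s4 : ({K : Finset (Sym2 V) | K ∉ pivEv a b c ∧ K ∉ pivEv b a c ∧ K ∉ pivEv c a b} : Set (Finset (Sym2 V))) =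
      (pivEv a b c)ᶜ ∩ (pivEv b a c)ᶜ ∩ (pivEv c a b)ᶜ := by
    ext K; simp only [Set.mem_setOf_eq, Set.mem_inter_iff, Set.mem_compl_iff, and_assoc]
  rw [s1] at h1; rw [s2] at h2; rw [s3] at h3; rw [s4] at h4
  rw [h1, h2, h3, h4]
  exact key

/-- **dR3 as a conditional positive correlation, measure form**: for `μ = prodBernoulli w` and pairwise distinct `a, b, c`, with
`H_a = {b ~ c off a}`, `H_b = {a ~ c off b}`, `H_c = {a ~ b off c}`:  `μ(H_b ∩ H_c) · μ(H_a ∩ H_c) ≤ μ(H_c) · μ(H_a ∩ H_b ∩ H_c)`, i.e.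
`μ(H_a ∩ H_b | H_c) ≥ μ(H_a | H_c) · μ(H_b | H_c)`. [this work] -/
theorem posCorr_prodBernoulli (w : Sym2 V → unitInterval) {a b c : V} (hab : a ≠ b) (hac : a ≠ c) (hbc : b ≠ c) :
    (prodBernoulli w).real {ω : BondConfig V | {e | e ∈ ω ∧ b ∉ e} ∈ openConn a c ∧ {e | e ∈ ω ∧ c ∉ e} ∈ openConn a b} *
        (prodBernoulli w).real {ω : BondConfig V | {e | e ∈ ω ∧ a ∉ e} ∈ openConn b c ∧ {e | e ∈ ω ∧ c ∉ e} ∈ openConn a b} ≤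
      (prodBernoulli w).real {ω : BondConfig V | {e | e ∈ ω ∧ c ∉ e} ∈ openConn a b} *
        (prodBernoulli w).real {ω : BondConfig V | {e | e ∈ ω ∧ a ∉ e} ∈ openConn b c ∧ {e | e ∈ ω ∧ b ∉ e} ∈ openConn a c ∧
          {e | e ∈ ω ∧ c ∉ e} ∈ openConn a b} := by
  obtain ⟨_instV⟩ := nonempty_fintype V
  have hp0 : ∀ e, 0 ≤ (w e : ℝ) := fun e => (w e).2.1
  have hp1 : ∀ e, (w e : ℝ) ≤ 1 := fun e => (w e).2.2
  have key := posCorr_PrW (p := fun e => (w e : ℝ)) Finset.univ hp0 hp1 hab hac hbc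
  have hco : ∀ (S : Finset (Sym2 V)) (u v : V),
      (↑S : Set (Sym2 V)) ∈ openConn u v ↔ (openGraph (↑S : Set (Sym2 V))).Reachable u v := fun _ _ _ => Iff.rfl
  have hcoe : ∀ (S : Finset (Sym2 V)) (x : V), (↑(S \ touch {x}) : Set (Sym2 V)) = {e | e ∈ (↑S : Set (Sym2 V)) ∧ x ∉ e} := by
    intro S x; ext e
    simp only [Finset.coe_sdiff, Set.mem_sdiff, Finset.mem_coe, mem_touch, Finset.mem_singleton, exists_eq_left, Set.mem_setOf_eq]
  have conv : ∀ P : Prop → Prop → Prop → Prop,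
      (prodBernoulli w).real {ω : BondConfig V | P ({e | e ∈ ω ∧ a ∉ e} ∈ openConn b c) ({e | e ∈ ω ∧ b ∉ e} ∈ openConn a c)
          ({e | e ∈ ω ∧ c ∉ e} ∈ openConn a b)} =
        PrW Finset.univ (fun e => (w e : ℝ))
          {K : Finset (Sym2 V) | P (K ∉ pivEv a b c) (K ∉ pivEv b a c) (K ∉ pivEv c a b)} := fun P =>
    prodBernoulli_real_eq_PrW_univ w fun S => by
      simp only [Set.mem_setOf_eq, mem_pivEv, mem_cl, not_not, hco, ← hcoe]
  have h1 := conv fun _ y z => y ∧ z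
  have h2 := conv fun x _ z => x ∧ z
  have h3 := conv fun _ _ z => z
  have h4 := conv fun x y z => x ∧ y ∧ z
  beta_reduce at h1 h2 h3 h4
  have s1 : ({K : Finset (Sym2 V) | K ∉ pivEv b a c ∧ K ∉ pivEv c a b} : Set (Finset (Sym2 V))) = (pivEv b a c)ᶜ ∩ (pivEv c a b)ᶜ := by
    ext K; simp only [Set.mem_setOf_eq, Set.mem_inter_iff, Set.mem_compl_iff]
  have s2 : ({K : Finset (Sym2 V) | K ∉ pivEv a b c ∧ K ∉ pivEv c a b} : Set (Finset (Sym2 V))) = (pivEv a b c)ᶜ ∩ (pivEv c a b)ᶜ := by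
    ext K; simp only [Set.mem_setOf_eq, Set.mem_inter_iff, Set.mem_compl_iff]
  have s3 : ({K : Finset (Sym2 V) | K ∉ pivEv c a b} : Set (Finset (Sym2 V))) = (pivEv c a b)ᶜ := by
    ext K; simp only [Set.mem_setOf_eq, Set.mem_compl_iff]
  have s4 : ({K : Finset (Sym2 V) | K ∉ pivEv a b c ∧ K ∉ pivEv b a c ∧ K ∉ pivEv c a b} : Set (Finset (Sym2 V))) =
      (pivEv a b c)ᶜ ∩ (pivEv b a c)ᶜ ∩ (pivEv c a b)ᶜ := by
    ext K; simp only [Set.mem_setOf_eq, Set.mem_inter_iff, Set.mem_compl_iff, and_assoc]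
  rw [s1] at h1; rw [s2] at h2; rw [s3] at h3; rw [s4] at h4
  rw [h1, h2, h3, h4]
  exact key

/-- **dR4⁺, measure form**: for `μ = prodBernoulli w` on any finite vertex type and pairwise distinct `a, b, c`,
`μ(H_b H_c ¬H_a) · (μ(H_a only) + μ(H_a H_b ¬H_c)) ≤ μ(H_b only) · (μ(H_a H_b H_c) + μ(H_a H_c ¬H_b))`, where `H_a = {b ~ c off a}`,
`H_b = {a ~ c off b}`, `H_c = {a ~ b off c}`; i.e. `P(H_c | H_b ¬H_a) ≤ P(H_c | H_a)`. [this work] -/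
theorem dualRowR4_prodBernoulli (w : Sym2 V → unitInterval) {a b c : V} (hab : a ≠ b) (hac : a ≠ c) (hbc : b ≠ c) :
    (prodBernoulli w).real {ω : BondConfig V | {e | e ∈ ω ∧ a ∉ e} ∉ openConn b c ∧ {e | e ∈ ω ∧ b ∉ e} ∈ openConn a c ∧
          {e | e ∈ ω ∧ c ∉ e} ∈ openConn a b} *
        ((prodBernoulli w).real {ω : BondConfig V | {e | e ∈ ω ∧ a ∉ e} ∈ openConn b c ∧ {e | e ∈ ω ∧ b ∉ e} ∉ openConn a c ∧
            {e | e ∈ ω ∧ c ∉ e} ∉ openConn a b} +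
          (prodBernoulli w).real {ω : BondConfig V | {e | e ∈ ω ∧ a ∉ e} ∈ openConn b c ∧ {e | e ∈ ω ∧ b ∉ e} ∈ openConn a c ∧
            {e | e ∈ ω ∧ c ∉ e} ∉ openConn a b}) ≤
      (prodBernoulli w).real {ω : BondConfig V | {e | e ∈ ω ∧ a ∉ e} ∉ openConn b c ∧ {e | e ∈ ω ∧ b ∉ e} ∈ openConn a c ∧
          {e | e ∈ ω ∧ c ∉ e} ∉ openConn a b} *
        ((prodBernoulli w).real {ω : BondConfig V | {e | e ∈ ω ∧ a ∉ e} ∈ openConn b c ∧ {e | e ∈ ω ∧ b ∉ e} ∈ openConn a c ∧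
            {e | e ∈ ω ∧ c ∉ e} ∈ openConn a b} +
          (prodBernoulli w).real {ω : BondConfig V | {e | e ∈ ω ∧ a ∉ e} ∈ openConn b c ∧ {e | e ∈ ω ∧ b ∉ e} ∉ openConn a c ∧
            {e | e ∈ ω ∧ c ∉ e} ∈ openConn a b}) := by
  obtain ⟨_instV⟩ := nonempty_fintype V
  have hp0 : ∀ e, 0 ≤ (w e : ℝ) := fun e => (w e).2.1
  have hp1 : ∀ e, (w e : ℝ) ≤ 1 := fun e => (w e).2.2
  have key := dualRowR4_H (p := fun e => (w e : ℝ)) Finset.univ hp0 hp1 hab hac hbc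
  have hco : ∀ (S : Finset (Sym2 V)) (u v : V),
      (↑S : Set (Sym2 V)) ∈ openConn u v ↔ (openGraph (↑S : Set (Sym2 V))).Reachable u v := fun _ _ _ => Iff.rfl
  have hcoe : ∀ (S : Finset (Sym2 V)) (x : V), (↑(S \ touch {x}) : Set (Sym2 V)) = {e | e ∈ (↑S : Set (Sym2 V)) ∧ x ∉ e} := by
    intro S x; ext e
    simp only [Finset.coe_sdiff, Set.mem_sdiff, Finset.mem_coe, mem_touch, Finset.mem_singleton, exists_eq_left, Set.mem_setOf_eq]
  -- transport of any Boolean combination of the three avoiding-connection events to the finitary `PrW` form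
  have conv : ∀ P : Prop → Prop → Prop → Prop,
      (prodBernoulli w).real {ω : BondConfig V | P ({e | e ∈ ω ∧ a ∉ e} ∈ openConn b c) ({e | e ∈ ω ∧ b ∉ e} ∈ openConn a c)
          ({e | e ∈ ω ∧ c ∉ e} ∈ openConn a b)} =
        PrW Finset.univ (fun e => (w e : ℝ))
          {K : Finset (Sym2 V) | P (K ∉ pivEv a b c) (K ∉ pivEv b a c) (K ∉ pivEv c a b)} := fun P =>
    prodBernoulli_real_eq_PrW_univ w fun S => by
      simp only [Set.mem_setOf_eq, mem_pivEv, mem_cl, not_not, hco, ← hcoe]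
  have h1 := conv fun x y z => ¬x ∧ y ∧ z
  have h2 := conv fun x y z => x ∧ ¬y ∧ ¬z
  have h3 := conv fun x y z => x ∧ y ∧ ¬z
  have h4 := conv fun x y z => ¬x ∧ y ∧ ¬z
  have h5 := conv fun x y z => x ∧ y ∧ z
  have h6 := conv fun x y z => x ∧ ¬y ∧ z
  beta_reduce at h1 h2 h3 h4 h5 h6
  simp only [not_not] at h1 h2 h3 h4 h5 h6
  have s1 : ({K : Finset (Sym2 V) | K ∈ pivEv a b c ∧ K ∉ pivEv b a c ∧ K ∉ pivEv c a b} : Set (Finset (Sym2 V))) =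
      pivEv a b c ∩ (pivEv b a c)ᶜ ∩ (pivEv c a b)ᶜ := by
    ext K; simp only [Set.mem_setOf_eq, Set.mem_inter_iff, Set.mem_compl_iff, and_assoc]
  have s2 : ({K : Finset (Sym2 V) | K ∉ pivEv a b c ∧ K ∈ pivEv b a c ∧ K ∈ pivEv c a b} : Set (Finset (Sym2 V))) =
      (pivEv a b c)ᶜ ∩ pivEv b a c ∩ pivEv c a b := by
    ext K; simp only [Set.mem_setOf_eq, Set.mem_inter_iff, Set.mem_compl_iff, and_assoc]
  have s3 : ({K : Finset (Sym2 V) | K ∉ pivEv a b c ∧ K ∉ pivEv b a c ∧ K ∈ pivEv c a b} : Set (Finset (Sym2 V))) =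
      (pivEv a b c)ᶜ ∩ (pivEv b a c)ᶜ ∩ pivEv c a b := by
    ext K; simp only [Set.mem_setOf_eq, Set.mem_inter_iff, Set.mem_compl_iff, and_assoc]
  have s4 : ({K : Finset (Sym2 V) | K ∈ pivEv a b c ∧ K ∉ pivEv b a c ∧ K ∈ pivEv c a b} : Set (Finset (Sym2 V))) =
      pivEv a b c ∩ (pivEv b a c)ᶜ ∩ pivEv c a b := by
    ext K; simp only [Set.mem_setOf_eq, Set.mem_inter_iff, Set.mem_compl_iff, and_assoc]
  have s5 : ({K : Finset (Sym2 V) | K ∉ pivEv a b c ∧ K ∉ pivEv b a c ∧ K ∉ pivEv c a b} : Set (Finset (Sym2 V))) =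
      (pivEv a b c)ᶜ ∩ (pivEv b a c)ᶜ ∩ (pivEv c a b)ᶜ := by
    ext K; simp only [Set.mem_setOf_eq, Set.mem_inter_iff, Set.mem_compl_iff, and_assoc]
  have s6 : ({K : Finset (Sym2 V) | K ∉ pivEv a b c ∧ K ∈ pivEv b a c ∧ K ∉ pivEv c a b} : Set (Finset (Sym2 V))) =
      (pivEv a b c)ᶜ ∩ pivEv b a c ∩ (pivEv c a b)ᶜ := by
    ext K; simp only [Set.mem_setOf_eq, Set.mem_inter_iff, Set.mem_compl_iff, and_assoc]
  rw [s1] at h1; rw [s2] at h2; rw [s3] at h3; rw [s4] at h4; rw [s5] at h5; rw [s6] at h6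
  rw [h1, h2, h3, h4, h5, h6]
  exact key

end Measure

end PivotalBHK

end Summit.CriticalPhenomena.PercolationContinuityZ3.Theorems

end
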